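import Summits.AtomisticToContinuum.FouriersLaw.Theorems.OddSectorIrreversibilityResponseDensityGibbsPairing
import Summits.AtomisticToContinuum.FouriersLaw.Theorems.OddSectorIrreversibilityResponseDensityRevGenerator
import Literature.MathematicalPhysics.KineticTheory.LangevinChainLyapunov
import Literature.MathematicalPhysics.KineticTheory.SdeGeneratorCalculus

/-!
# The backward identity for Gibbs-weighted pairings of the pinned chain (truncated form)

Helper file for item stmt-AtomisticToContinuum-9144 (`ResponseDensity`, route
`OddSectorIrreversibility`, sub-problem `FouriersLaw` of `AtomisticToContinuum`).

The backward Dynkin identity of `ConfinedBackward.lean` (duality with respect to Lebesgue measure +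
Dynkin for the reversed kernels) applied to the compactly supported pair observable
`H_R(x, y) = χ(H(x)/R) e^{θH(x)} · χ(H(y)/R) φ(y)` of the pinned chain:
`∫ χ_R e^{θH} P_t(χ_R φ) dx = e^{2γt} (∫ χ_R e^{θH} χ_R φ dx + ∫₀ᵗ e^{-2γs} ∫ P_s(χ_R φ) L̂(χ_R e^{θH}) dx ds)`,
with `L̂` the generator of the momentum-reversed drift (`L̂ + 2γ = Lᵀ`). No definitions.
-/

noncomputable section

open MeasureTheory ProbabilityTheory Filter Topology Set
open scoped NNReal ENNReal ContDiff

namespace Summit.AtomisticToContinuum.FouriersLaw.Theorems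

open Literature.MathematicalPhysics.KineticTheory.HeatConduction
open Literature.Probability.Process Literature.MathematicalPhysics.KineticTheory OscillatorChain

variable {N : ℕ}

section PairObservable

variable (ω₂ lam β γ : ℝ) (N : ℕ) (θ R : ℝ)

/-- `χ(H/R) e^{θH}` is `C²`. -/
theorem contDiff_cutoffExp_hamiltonian :
    ContDiff ℝ 2 (fun y : PhaseSpace N =>
      smoothCutoff ((pinnedChain ω₂ lam β γ).hamiltonian N y / R) *
        Real.exp (θ * (pinnedChain ω₂ lam β γ).hamiltonian N y)) :=
  ((contDiff_cutoffExp θ R).comp (pinnedChain_contDiff_hamiltonian ω₂ lam β γ N)).of_le (by norm_cast)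

variable {φ : PhaseSpace N → ℝ}

/-- The pair observable `H_R(x,y) = χ(H(x)/R) e^{θH(x)} · χ(H(y)/R) φ(y)` is `C²` for `φ ∈ C²`. -/
theorem contDiff_truncPair (hφ2 : ContDiff ℝ 2 φ) :
    ContDiff ℝ 2 (fun p : PhaseSpace N × PhaseSpace N =>
      (smoothCutoff ((pinnedChain ω₂ lam β γ).hamiltonian N p.1 / R) *
          Real.exp (θ * (pinnedChain ω₂ lam β γ).hamiltonian N p.1)) *
        (smoothCutoff ((pinnedChain ω₂ lam β γ).hamiltonian N p.2 / R) * φ p.2)) := by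
  have hHs : ContDiff ℝ ∞ ((pinnedChain ω₂ lam β γ).hamiltonian N) :=
    pinnedChain_contDiff_hamiltonian ω₂ lam β γ N
  have h1 : ContDiff ℝ ∞ (fun p : PhaseSpace N × PhaseSpace N =>
      smoothCutoff ((pinnedChain ω₂ lam β γ).hamiltonian N p.1 / R) *
        Real.exp (θ * (pinnedChain ω₂ lam β γ).hamiltonian N p.1)) :=
    (contDiff_cutoffExp θ R).comp (hHs.comp contDiff_fst)
  have h2 : ContDiff ℝ ∞ (fun p : PhaseSpace N × PhaseSpace N =>
      smoothCutoff ((pinnedChain ω₂ lam β γ).hamiltonian N p.2 / R)) :=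
    (contDiff_smoothCutoff (n := ⊤)).comp ((hHs.comp contDiff_snd).div_const R)
  have h3 : ContDiff ℝ 2 (fun p : PhaseSpace N × PhaseSpace N => φ p.2) := hφ2.comp contDiff_snd
  exact (h1.of_le (by norm_cast)).mul ((h2.of_le (by norm_cast)).mul h3)

variable {ω₂ lam β R}

/-- The pair observable has compact support (`ω₂ > 0`, `lam, β ≥ 0`, `R > 0`). -/
theorem hasCompactSupport_truncPair (hω : 0 < ω₂) (hl : 0 ≤ lam) (hβ : 0 ≤ β) (φ : PhaseSpace N → ℝ)
    (hR : 0 < R) :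
    HasCompactSupport (fun p : PhaseSpace N × PhaseSpace N =>
      (smoothCutoff ((pinnedChain ω₂ lam β γ).hamiltonian N p.1 / R) *
          Real.exp (θ * (pinnedChain ω₂ lam β γ).hamiltonian N p.1)) *
        (smoothCutoff ((pinnedChain ω₂ lam β γ).hamiltonian N p.2 / R) * φ p.2)) := by
  have hK : IsCompact {x : PhaseSpace N | (pinnedChain ω₂ lam β γ).hamiltonian N x ≤ 2 * R} :=
    pinnedChain_isCompact_setOf_hamiltonian_le hω hl hβ γ N (2 * R)
  refine HasCompactSupport.intro (hK.prod hK) fun p hp => ?_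
  rw [Set.mem_prod, not_and_or] at hp
  rcases hp with h | h
  · simp only [Set.mem_setOf_eq, not_le] at h
    rw [cutoffExp_of_ge θ hR h.le, zero_mul]
  · simp only [Set.mem_setOf_eq, not_le] at h
    rw [smoothCutoff_of_two_le ((le_div_iff₀ hR).2 h.le), zero_mul, mul_zero]

variable (ω₂ lam β R) (T_L T_R : ℝ)

/-- **The first-variable reversed generator of the pair observable**:
`L̂₁ H_R (x, y) = χ(H(y)/R) φ(y) · L̂(χ(H/R) e^{θH})(x)`. -/
theorem sdeGeneratorFst_truncPair (φ : PhaseSpace N → ℝ) (x y : PhaseSpace N) :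
    sdeGeneratorFst (fun y => -(pinnedChain ω₂ lam β γ).drift N y)
        ((pinnedChain ω₂ lam β γ).bathVecL N T_L) ((pinnedChain ω₂ lam β γ).bathVecR N T_R)
        (fun p : PhaseSpace N × PhaseSpace N =>
          (smoothCutoff ((pinnedChain ω₂ lam β γ).hamiltonian N p.1 / R) *
              Real.exp (θ * (pinnedChain ω₂ lam β γ).hamiltonian N p.1)) *
            (smoothCutoff ((pinnedChain ω₂ lam β γ).hamiltonian N p.2 / R) * φ p.2)) (x, y) =
      (smoothCutoff ((pinnedChain ω₂ lam β γ).hamiltonian N y / R) * φ y) *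
        sdeGenerator (fun y => -(pinnedChain ω₂ lam β γ).drift N y)
          ((pinnedChain ω₂ lam β γ).bathVecL N T_L) ((pinnedChain ω₂ lam β γ).bathVecR N T_R)
          (fun y => smoothCutoff ((pinnedChain ω₂ lam β γ).hamiltonian N y / R) *
            Real.exp (θ * (pinnedChain ω₂ lam β γ).hamiltonian N y)) x := by
  rw [sdeGeneratorFst_apply]
  simp only []
  have : (fun x' : PhaseSpace N =>
      (smoothCutoff ((pinnedChain ω₂ lam β γ).hamiltonian N x' / R) *
          Real.exp (θ * (pinnedChain ω₂ lam β γ).hamiltonian N x')) *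
        (smoothCutoff ((pinnedChain ω₂ lam β γ).hamiltonian N y / R) * φ y)) = fun x' =>
      (smoothCutoff ((pinnedChain ω₂ lam β γ).hamiltonian N y / R) * φ y) *
        (smoothCutoff ((pinnedChain ω₂ lam β γ).hamiltonian N x' / R) *
          Real.exp (θ * (pinnedChain ω₂ lam β γ).hamiltonian N x')) := funext fun x' => by ring
  rw [this, sdeGenerator_const_mul _ _ _ (contDiff_cutoffExp_hamiltonian ω₂ lam β γ N θ R)]

end PairObservable

section Truncated

variable {ω₂ lam β γ : ℝ} (hω : 0 < ω₂) (hl : 0 ≤ lam) (hβ : 0 ≤ β) (hγ : 0 < γ)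
  (hN : 0 < N) (T_L T_R : ℝ) (θ : ℝ)
  {φ : PhaseSpace N → ℝ} (hφ2 : ContDiff ℝ 2 φ)
include hω hl hβ hγ

/-- **The pair action of `L̂₁ H_R` in kernel form**:
`pairAct (L̂₁ H_R) s = ∫ P_s(χ_R φ)(x) · L̂(χ_R e^{θH})(x) dx`. -/
theorem pairAct_sdeGeneratorFst_truncPair (R : ℝ) (φ : PhaseSpace N → ℝ) (s : ℝ≥0) :
    pairAct ((pinnedChain ω₂ lam β γ).drift N) ((pinnedChain ω₂ lam β γ).bathVecL N T_L)
        ((pinnedChain ω₂ lam β γ).bathVecR N T_R) volume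
        (sdeGeneratorFst (fun y => -(pinnedChain ω₂ lam β γ).drift N y)
          ((pinnedChain ω₂ lam β γ).bathVecL N T_L) ((pinnedChain ω₂ lam β γ).bathVecR N T_R)
          (fun p : PhaseSpace N × PhaseSpace N =>
            (smoothCutoff ((pinnedChain ω₂ lam β γ).hamiltonian N p.1 / R) *
                Real.exp (θ * (pinnedChain ω₂ lam β γ).hamiltonian N p.1)) *
              (smoothCutoff ((pinnedChain ω₂ lam β γ).hamiltonian N p.2 / R) * φ p.2))) s =
      ∫ x, (∫ y, smoothCutoff ((pinnedChain ω₂ lam β γ).hamiltonian N y / R) * φ y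
          ∂((pinnedChain ω₂ lam β γ).transitionKernel N T_L T_R s x)) *
        sdeGenerator (fun y => -(pinnedChain ω₂ lam β γ).drift N y)
          ((pinnedChain ω₂ lam β γ).bathVecL N T_L) ((pinnedChain ω₂ lam β γ).bathVecR N T_R)
          (fun y => smoothCutoff ((pinnedChain ω₂ lam β γ).hamiltonian N y / R) *
            Real.exp (θ * (pinnedChain ω₂ lam β γ).hamiltonian N y)) x := by
  rw [pairAct_def]
  simp_rw [sdeGeneratorFst_truncPair ω₂ lam β γ N θ R T_L T_R φ]
  simp only [integral_mul_const, pinnedChain_sdeKernel_eq_transitionKernel N T_L T_R hω hl hβ hγ.le]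

include hφ2 in
/-- **The kernel-form pair action of `L̂₁ H_R` is continuous in time** (`R > 0`). -/
theorem continuous_pairing_truncPair {R : ℝ} (hR : 0 < R) :
    Continuous fun s : ℝ =>
      ∫ x, (∫ y, smoothCutoff ((pinnedChain ω₂ lam β γ).hamiltonian N y / R) * φ y
          ∂((pinnedChain ω₂ lam β γ).transitionKernel N T_L T_R s.toNNReal x)) *
        sdeGenerator (fun y => -(pinnedChain ω₂ lam β γ).drift N y)
          ((pinnedChain ω₂ lam β γ).bathVecL N T_L) ((pinnedChain ω₂ lam β γ).bathVecR N T_R)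
          (fun y => smoothCutoff ((pinnedChain ω₂ lam β γ).hamiltonian N y / R) *
            Real.exp (θ * (pinnedChain ω₂ lam β γ).hamiltonian N y)) x := by
  haveI := isAddHaarMeasure_volume_phaseSpace N
  have hPc : (pinnedChain ω₂ lam β γ).IsConfining := SubdiffusiveBondHeat.pinnedChain_isConfining hω hl hβ hγ.le
  have hU : ContDiff ℝ ∞ (pinnedChain ω₂ lam β γ).U := pinnedChain_contDiff_U ω₂ lam β γ
  have hV : ContDiff ℝ ∞ (pinnedChain ω₂ lam β γ).V := pinnedChain_contDiff_V ω₂ lam β γ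
  have hY'c : Continuous fun y => -(pinnedChain ω₂ lam β γ).drift N y :=
    ((pinnedChain ω₂ lam β γ).contDiff_drift hU hV N).continuous.neg
  simp_rw [← pairAct_sdeGeneratorFst_truncPair hω hl hβ hγ T_L T_R θ R φ]
  exact (hPc.confinedDrift N).toConfinedDrift.continuous_pairAct (hPc.bathVecL_mem_noise N T_L)
    (hPc.bathVecR_mem_noise N T_R) volume
    (continuous_sdeGeneratorFst hY'c (contDiff_truncPair ω₂ lam β γ N θ R hφ2))
    (hasCompactSupport_sdeGeneratorFst (hasCompactSupport_truncPair γ N θ hω hl hβ φ hR))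

include hN hφ2 in
/-- **The truncated backward identity.** For `R = n + 1`, `χ_R = χ(H/R)` and `t > 0`:
`∫ χ_R e^{θH} · P_t(χ_R φ) dx
   = e^{2γt} (∫ χ_R e^{θH} χ_R φ dx + ∫₀ᵗ e^{-2γs} ∫ P_s(χ_R φ) · L̂(χ_R e^{θH}) dx ds)`,
`L̂` the generator of the momentum-reversed drift (`L̂ + 2γ = Lᵀ`). -/
theorem pinnedChain_truncated_backward_identity (n : ℕ) {t : ℝ≥0} (ht : 0 < t) :
    ∫ x, (smoothCutoff ((pinnedChain ω₂ lam β γ).hamiltonian N x / (n + 1)) *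
          Real.exp (θ * (pinnedChain ω₂ lam β γ).hamiltonian N x)) *
        ∫ y, smoothCutoff ((pinnedChain ω₂ lam β γ).hamiltonian N y / (n + 1)) * φ y
          ∂((pinnedChain ω₂ lam β γ).transitionKernel N T_L T_R t x) =
      Real.exp (2 * γ * t) *
        ((∫ x, (smoothCutoff ((pinnedChain ω₂ lam β γ).hamiltonian N x / (n + 1)) *
            Real.exp (θ * (pinnedChain ω₂ lam β γ).hamiltonian N x)) *
            (smoothCutoff ((pinnedChain ω₂ lam β γ).hamiltonian N x / (n + 1)) * φ x)) +
          ∫ s in (0 : ℝ)..t, Real.exp (-(2 * γ * s)) *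
            ∫ x, (∫ y, smoothCutoff ((pinnedChain ω₂ lam β γ).hamiltonian N y / (n + 1)) * φ y
                ∂((pinnedChain ω₂ lam β γ).transitionKernel N T_L T_R s.toNNReal x)) *
              sdeGenerator (fun y => -(pinnedChain ω₂ lam β γ).drift N y)
                ((pinnedChain ω₂ lam β γ).bathVecL N T_L) ((pinnedChain ω₂ lam β γ).bathVecR N T_R)
                (fun y => smoothCutoff ((pinnedChain ω₂ lam β γ).hamiltonian N y / (n + 1)) *
                  Real.exp (θ * (pinnedChain ω₂ lam β γ).hamiltonian N y)) x) := by
  haveI := isAddHaarMeasure_volume_phaseSpace N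
  have hPc : (pinnedChain ω₂ lam β γ).IsConfining := SubdiffusiveBondHeat.pinnedChain_isConfining hω hl hβ hγ.le
  have hU : ContDiff ℝ ∞ (pinnedChain ω₂ lam β γ).U := pinnedChain_contDiff_U ω₂ lam β γ
  have hV : ContDiff ℝ ∞ (pinnedChain ω₂ lam β γ).V := pinnedChain_contDiff_V ω₂ lam β γ
  have hR : (0 : ℝ) < n + 1 := by positivity
  -- the backward Dynkin identity for the pair observable
  have hid := (hPc.confinedDrift N).toConfinedDrift.pairAct_eq_of_contDiff
    (hPc.bathVecL_mem_noise N T_L) (hPc.bathVecR_mem_noise N T_R) volume (hPc.reversedDrift N)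
    (hPc.bathVecL_mem_reversedDrift_noise N T_L) (hPc.bathVecR_mem_reversedDrift_noise N T_R)
    (fun _ => rfl) ((pinnedChain ω₂ lam β γ).trace_fderiv_drift hU hV hN)
    (contDiff_truncPair ω₂ lam β γ N θ (n + 1) hφ2) (hasCompactSupport_truncPair γ N θ hω hl hβ φ hR) ht
  rw [pairAct_def] at hid
  simp_rw [pairAct_sdeGeneratorFst_truncPair hω hl hβ hγ T_L T_R θ (n + 1) φ] at hid
  simp only [integral_const_mul, pinnedChain_sdeKernel_eq_transitionKernel N T_L T_R hω hl hβ hγ.le,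
    show (pinnedChain ω₂ lam β γ).γ = γ from rfl, neg_mul, neg_neg] at hid
  exact hid

end Truncated

end Summit.AtomisticToContinuum.FouriersLaw.Theorems

end
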